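import Literature.Geometry.Riemannian.HeatKernelLogSobolev
import Mathlib.Analysis.SpecialFunctions.Pow.Deriv
import Mathlib.Analysis.Convex.Integral
import Mathlib.Analysis.Convex.SpecificFunctions.Basic
import HarnessLib

/-!
# Hypercontractivity of the heat flow against the conjugate heat kernel measures of a Ricci flow
# (Bamler 2020a, Thm. 12.1)

R. Bamler, *Entropy and heat kernel bounds on a Ricci flow background*, arXiv:2008.07093 (2020a),
§12, Thm. 12.1: on a Ricci flow on a closed manifold with conjugate heat kernel measures
`dν_s = dν_{x,t;s} = K(x,t;·,s) dg_s`, let `s₂ < s₁ < t` and `1 < q ≤ p` with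
`(p − 1)(t − s₁) ≤ (q − 1)(t − s₂)`, i.e. `(t − s₁)/(p − 1) ≥ (t − s₂)/(q − 1)`. Then every positive
solution `u` of the heat equation `∂ₛu = Δ_{g_s}u` on `M × [s₂, s₁]` satisfies

  `(∫ u(s₁)^p dν_{s₁})^{1/p} ≤ (∫ u(s₂)^q dν_{s₂})^{1/q}`.

This file proves it for a Ricci flow `hflow = (h, cov)` on `[a, T]` of a `C^∞` family of
Riemannian metrics on a closed connected manifold `M` (modelled on `ℝᵐ`), `a < s₂ < s₁ < t ≤ T`,
with the tree's heat kernel measures `ν_{x,t;s} = heatKernelMeasure hh hR t x s`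
(`HeatKernelMeasures.lean`) and `C^∞` positive heat solutions `u`, by Gross's argument (Gross 1975;
Bamler 2020a, §12.2) from the Hein–Naber log-Sobolev inequality
`heinNaber_logSobolev_heatKernelMeasure` (`HeatKernelLogSobolev.lean`):

* `hypercontractivity_heatKernelMeasure` — the estimate above. With the increasing exponent
  `P(r) = 1 + (q − 1)(t − s₂)/(t − r)` on `[s₂, s₁]` (`P(s₂) = q`, `P(s₁) ≥ p`,
  `Ṗ (t − r) = P − 1`) and `Z(r) = ∫ u(r)^{P(r)} dν_r`, the pairing of the smooth space-time
  function `u^P` with the conjugate heat solution `K(x,t;·,·)`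
  (`IsRicciFlow.hasDerivWithinAt_integral_mul_conjugateHeat`) gives
  `Z' = ∫ (Ṗ u^P log u − P(P − 1) u^{P−2}|∇u|²) dν_r`, while the log-Sobolev inequality for
  `φ = u^P` (`φ log φ = P u^P log u`, `|∇φ|²/φ = P² u^{P−2}|∇u|²`) gives
  `P ∫ u^P log u dν_r − Z log Z ≤ (t − r) P² ∫ u^{P−2}|∇u|² dν_r`; hence `Z' ≤ (Ṗ/P) Z log Z`, i.e.
  `r ↦ log Z(r) / P(r)` is non-increasing, `Z(s₁)^{1/P(s₁)} ≤ Z(s₂)^{1/q}`, and finally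
  `(∫ u(s₁)^p dν_{s₁})^{1/p} ≤ Z(s₁)^{1/P(s₁)}` by Jensen's inequality (`p ≤ P(s₁)`, `ν_{s₁}` is a
  probability measure).

Everything is proved; no definitions, no named facts. What is NOT here: the end point cases
`s₁ = t` (`ν_{x,t;t} = δ_x`) and `q = 1`, heat solutions of lower regularity or `u ≥ 0`, the
Gaussian concentration and heat kernel bounds Bamler derives next (Thm. 12.2 ff.), super Ricci
flows and non-compact `M`.

## References

* R. H. Bamler, *Entropy and heat kernel bounds on a Ricci flow background*, arXiv:2008.07093
  (2020), §12, Thm. 12.1. [Bamler2020Entropy]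
* H.-J. Hein, A. Naber, *New logarithmic Sobolev inequalities and an ε-regularity theorem for the
  Ricci flow*, Comm. Pure Appl. Math. 67 (2014), 1543–1561, Thm. 1.10. [HeinNaber2014]
* L. Gross, *Logarithmic Sobolev inequalities*, Amer. J. Math. 97 (1975), 1061–1083.
  [Gross1975]
-/

noncomputable section

open Bundle Set Function Filter Manifold MeasureTheory Measure TopologicalSpace
open scoped Manifold ContDiff Topology ENNReal NNReal

namespace Literature.Geometry.Riemannian

open Lorentzian Lorentzian.PseudoRiemannianMetric

section Hypercontractivity

variable {m : ℕ} {H : Type*} [TopologicalSpace H]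
  {I : ModelWithCorners ℝ (EuclideanSpace ℝ (Fin m)) H} [I.Boundaryless]
  {M : Type*} [TopologicalSpace M] [ChartedSpace H M] [IsManifold I ∞ M]
  [T2Space M] [CompactSpace M] [SecondCountableTopology M] [MeasurableSpace M] [BorelSpace M]
  [PreconnectedSpace M]
  {h : ℝ → PseudoRiemannianMetric I ∞ (EuclideanSpace ℝ (Fin m)) (TangentSpace I : M → Type _)}
  {cov : ℝ → CovariantDerivative I (EuclideanSpace ℝ (Fin m)) (TangentSpace I : M → Type _)}
  {a T : ℝ}

omit [I.Boundaryless] [T2Space M] [CompactSpace M] [SecondCountableTopology M] [MeasurableSpace M]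
  [BorelSpace M] [PreconnectedSpace M] in
/-- **Gradient square of a real power**: `|∇(f^P)|²_g(x) = (P f(x)^{P−1})² |∇f|²_g(x)` for `f`
differentiable at `x` with `f(x) ≠ 0` (`d(f^P) = P f^{P−1} df`, `mvfderiv_real_comp`). [folklore] -/
private theorem gradSq_fun_rpow
    (g : PseudoRiemannianMetric I ∞ (EuclideanSpace ℝ (Fin m)) (TangentSpace I : M → Type _))
    {f : M → ℝ} {x : M} (hf : MDifferentiableAt I 𝓘(ℝ, ℝ) f x) (hx : f x ≠ 0) (P : ℝ) :
    g.gradSq (fun y ↦ f y ^ P) x = (P * f x ^ (P - 1)) ^ 2 * g.gradSq f x := by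
  have hζ : DifferentiableAt ℝ (fun v : ℝ ↦ v ^ P) (f x) :=
    (Real.hasDerivAt_rpow_const (Or.inl hx)).differentiableAt
  have hd : mvfderiv I (fun y ↦ f y ^ P) x = (P * f x ^ (P - 1)) • mvfderiv I f x := by
    ext v
    rw [show (fun y ↦ f y ^ P) = (fun v : ℝ ↦ v ^ P) ∘ f from rfl, mvfderiv_real_comp hζ hf v,
      Real.deriv_rpow_const, _root_.smul_apply, smul_eq_mul]
  simp only [PseudoRiemannianMetric.gradSq_eq, hd, ContinuousLinearMap.toLinearMap_smul, map_smul,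
    _root_.smul_apply, smul_eq_mul]
  ring

omit [I.Boundaryless] [T2Space M] [CompactSpace M] [SecondCountableTopology M] [MeasurableSpace M]
  [BorelSpace M] [PreconnectedSpace M] in
/-- **The Laplacian of a real power**:
`Δ_g(f^P)(x) = P(P − 1) f(x)^{P−2} |∇f|²_g(x) + P f(x)^{P−1} Δ_g f(x)` for `f` of class `C²` at `x`
with `f(x) ≠ 0` (the chain rule `Δ(ζ ∘ f) = ζ''(f)|∇f|² + ζ'(f)Δf`, `dalembertian_real_comp`, with
`ζ(v) = v^P`, Mathlib's `Real.deriv_rpow_const`). [folklore] -/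
private theorem laplaceBeltrami_fun_rpow
    (g : PseudoRiemannianMetric I ∞ (EuclideanSpace ℝ (Fin m)) (TangentSpace I : M → Type _))
    {f : M → ℝ} {x : M} (hf : ContMDiffAt I 𝓘(ℝ, ℝ) 2 f x) (hx : f x ≠ 0) (P : ℝ) :
    g.laplaceBeltrami (fun y ↦ f y ^ P) x =
      P * (P - 1) * f x ^ (P - 2) * g.gradSq f x + P * f x ^ (P - 1) * g.laplaceBeltrami f x := by
  haveI := g.hasLeviCivita
  have hζ : ContDiffAt ℝ 2 (fun v : ℝ ↦ v ^ P) (f x) := Real.contDiffAt_rpow_const_of_ne hx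
  have h1 : deriv (fun v : ℝ ↦ v ^ P) = fun v ↦ P * v ^ (P - 1) := Real.deriv_rpow_const' P
  have h2 : deriv (deriv (fun v : ℝ ↦ v ^ P)) (f x) = P * ((P - 1) * f x ^ (P - 2)) := by
    rw [h1, deriv_const_mul_field']
    beta_reduce
    rw [Real.deriv_rpow_const, show P - 1 - 1 = P - 2 by ring]
  rw [laplaceBeltrami_eq_dalembertian, laplaceBeltrami_eq_dalembertian,
    show (fun y ↦ f y ^ P) = (fun v : ℝ ↦ v ^ P) ∘ f from rfl, g.dalembertian_real_comp hf hζ, h2,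
    h1]
  simp only [PseudoRiemannianMetric.gradSq]
  ring

/-- **Hypercontractivity of the heat flow against the conjugate heat kernel measures of a Ricci
flow** (Bamler 2020a, Thm. 12.1; Gross's theorem "log-Sobolev ⟹ hypercontractivity" for the
Hein–Naber log-Sobolev inequality): for a Ricci flow `(h, cov)` on `[a, T]` of a smooth family of
Riemannian metrics on a closed connected manifold `M`, `a < s₂ < s₁ < t ≤ T`, `x ∈ M`, exponents
`1 < q ≤ p` with `(p − 1)(t − s₁) ≤ (q − 1)(t − s₂)`, and a smooth positive solution `u` of the
heat equation `∂ᵣu = Δ_{h(r)}u` on `M × [s₂, s₁]` (time derivatives within `[s₂, s₁]`),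

  `(∫ u(s₁)^p dν_{x,t;s₁})^{1/p} ≤ (∫ u(s₂)^q dν_{x,t;s₂})^{1/q}`.

Proof (Gross's method, Bamler 2020a §12): with `P(r) = 1 + (q − 1)(t − s₂)/(t − r)`,
`Z(r) = ∫ u(r)^{P(r)} dν_{x,t;r} = ∫ u^P K(x,t;·,r) dV_{h(r)}` has derivative
`∫ (∂ᵣ(u^P) − Δ(u^P)) dν_r = ∫ (Ṗ u^P log u − P(P−1)u^{P−2}|∇u|²) dν_r` within `[s₂, s₁]`
(`IsRicciFlow.hasDerivWithinAt_integral_mul_conjugateHeat`), which the log-Sobolev inequality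
`heinNaber_logSobolev_heatKernelMeasure` for `φ = u^P` and `Ṗ(t − r) = P − 1` bound by
`(Ṗ/P) Z log Z`; so `log Z / P` is non-increasing (`antitoneOn_of_hasDerivWithinAt_nonpos`),
`Z(s₁)^{1/P(s₁)} ≤ Z(s₂)^{1/q}`, and `(∫ u(s₁)^p dν_{s₁})^{1/p} ≤ Z(s₁)^{1/P(s₁)}` by Jensen
(`ConvexOn.map_integral_le`, `p ≤ P(s₁)`). [cite: Bamler2020Entropy, §12, Thm. 12.1]
[cite: HeinNaber2014, Thm. 1.10]
[cite: Gross1975, hypercontractivity from the log-Sobolev inequality] -/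
theorem hypercontractivity_heatKernelMeasure (hflow : IsRicciFlow h cov (Icc a T))
    (hh : IsContMDiffFamilyOn ∞ h univ) (hR : ∀ r, (h r).IsRiemannian) {s₂ s₁ t : ℝ}
    (has₂ : a < s₂) (h21 : s₂ < s₁) (hs₁t : s₁ < t) (htT : t ≤ T) (x : M) {p q : ℝ}
    (hq : 1 < q) (hqp : q ≤ p) (hpq : (p - 1) * (t - s₁) ≤ (q - 1) * (t - s₂))
    {u : ℝ → M → ℝ}
    (hu : ContMDiffOn (I.prod 𝓘(ℝ, ℝ)) 𝓘(ℝ, ℝ) ∞ (fun p : M × ℝ ↦ u p.2 p.1) (univ ×ˢ Icc s₂ s₁))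
    (hheat : ∀ r ∈ Icc s₂ s₁, ∀ y : M,
      HasDerivWithinAt (fun r' ↦ u r' y) ((h r).laplaceBeltrami (u r) y) (Icc s₂ s₁) r)
    (hupos : ∀ r ∈ Icc s₂ s₁, ∀ y : M, 0 < u r y) :
    (∫ y, u s₁ y ^ p ∂(heatKernelMeasure hh hR t x s₁)) ^ (1 / p) ≤
      (∫ y, u s₂ y ^ q ∂(heatKernelMeasure hh hR t x s₂)) ^ (1 / q) := by
  -- elementary orderings
  have hs₂t : s₂ < t := h21.trans hs₁t
  have ht : t ∈ Ioc a T := ⟨has₂.trans hs₂t, htT⟩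
  have hq0 : 0 < q := one_pos.trans hq
  have hp0 : 0 < p := hq0.trans_le hqp
  have h2le : (2 : ℕ∞ω) ≤ ((⊤ : ℕ∞) : ℕ∞ω) := WithTop.coe_le_coe.mpr le_top
  have hU : UniqueDiffOn ℝ (Icc s₂ s₁) := uniqueDiffOn_Icc h21
  have hflow' : IsRicciFlow h cov (Icc s₂ s₁) :=
    hflow.mono (Icc_subset_Icc has₂.le (hs₁t.le.trans htT))
  have hIt : ∀ r ∈ Icc s₂ s₁, r ∈ Ioo a t := fun r hr ↦ ⟨has₂.trans_le hr.1, hr.2.trans_lt hs₁t⟩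
  have htr : ∀ r ∈ Icc s₂ s₁, 0 < t - r := fun r hr ↦ sub_pos.2 (hr.2.trans_lt hs₁t)
  -- the exponent `P r = 1 + c/(t − r)`, `c = (q − 1)(t − s₂) > 0`, and its derivative `P'`
  set c : ℝ := (q - 1) * (t - s₂) with hc
  have hc0 : 0 < c := mul_pos (sub_pos.2 hq) (sub_pos.2 hs₂t)
  set P : ℝ → ℝ := fun r ↦ 1 + c / (t - r) with hP
  set P' : ℝ → ℝ := fun r ↦ c / (t - r) ^ 2 with hP'
  have hP0 : ∀ r ∈ Icc s₂ s₁, 0 < P r := fun r hr ↦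
    one_pos.trans (lt_add_of_pos_right _ (div_pos hc0 (htr r hr)))
  have hP'0 : ∀ r ∈ Icc s₂ s₁, 0 < P' r := fun r hr ↦ div_pos hc0 (pow_pos (htr r hr) 2)
  have hPd : ∀ r ∈ Icc s₂ s₁, HasDerivAt P (P' r) r := by
    intro r hr
    have h1 : HasDerivAt (fun r' : ℝ ↦ t - r') (-1) r := (hasDerivAt_id r).const_sub t
    have h2 := ((h1.inv (htr r hr).ne').const_mul c).const_add 1
    rw [show P = fun r' ↦ 1 + c * (t - r')⁻¹ by funext r'; simp only [hP, div_eq_mul_inv]]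
    refine h2.congr_deriv ?_
    simp only [hP']
    ring
  have hPrel : ∀ r ∈ Icc s₂ s₁, P' r * (t - r) = P r - 1 := by
    intro r hr
    have h0 := (htr r hr).ne'
    simp only [hP, hP']
    field_simp
    ring
  have hPs₂ : P s₂ = q := by
    have h0 := (htr s₂ (left_mem_Icc.2 h21.le)).ne'
    simp only [hP, hc]
    field_simp
    ring
  have hpP : p ≤ P s₁ := by
    have h1 : p - 1 ≤ c / (t - s₁) := (le_div_iff₀ (htr s₁ (right_mem_Icc.2 h21.le))).2 hpq
    simp only [hP]
    linarith
  have hPsm : ContMDiffOn (I.prod 𝓘(ℝ, ℝ)) 𝓘(ℝ, ℝ) ∞ (fun z : M × ℝ ↦ P z.2)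
      (univ ×ˢ Icc s₂ s₁) :=
    contMDiff_const.contMDiffOn.add (contMDiff_const.contMDiffOn.div₀
      (contMDiff_const.sub contMDiff_snd).contMDiffOn fun z hz ↦ (htr z.2 hz.2).ne')
  -- the kernel `K = K(x,t;·,·)`, a conjugate heat solution on `[s₂, s₁] ⊂ (a, t)`
  set K : M × ℝ → ℝ := hflow.heatKernelFn hh hR t x with hKdef
  have hKs : ContMDiffOn (I.prod 𝓘(ℝ, ℝ)) 𝓘(ℝ, ℝ) ∞ K (univ ×ˢ Ioo a t) :=
    hflow.heatKernelFn_contMDiffOn hh hR ht x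
  have hKpde : ∀ z ∈ univ ×ˢ Ioo a t, deriv (fun s ↦ K (z.1, s)) z.2 =
      -(h z.2).laplaceBeltrami (fun y ↦ K (y, z.2)) z.1 +
        (h z.2).scalarCurvatureWith (cov z.2) z.1 * K z := fun z hz ↦
    hflow.deriv_heatKernelFn_time hh hR ht x hz
  have hsol : IsConjugateHeatSolutionOn h cov (Icc s₂ s₁) fun r y ↦ K (y, r) :=
    isConjugateHeatSolutionOn_of_kernel hKs hKpde has₂ h21 hs₁t
  -- the test function `ζ r y = u r y ^ P r`, smooth on `M × [s₂, s₁]`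
  set ζ : ℝ → M → ℝ := fun r y ↦ u r y ^ P r with hζdef
  have hζs : ContMDiffOn (I.prod 𝓘(ℝ, ℝ)) 𝓘(ℝ, ℝ) ∞ (fun z : M × ℝ ↦ ζ z.2 z.1)
      (univ ×ˢ Icc s₂ s₁) := by
    have hlog : ContMDiffOn (I.prod 𝓘(ℝ, ℝ)) 𝓘(ℝ, ℝ) ∞ (fun z : M × ℝ ↦ Real.log (u z.2 z.1))
        (univ ×ˢ Icc s₂ s₁) := fun z hz ↦
      ContDiffAt.comp_contMDiffWithinAt (g := Real.log) (f := fun z : M × ℝ ↦ u z.2 z.1) (x := z)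
        (Real.contDiffAt_log.2 (hupos z.2 hz.2 z.1).ne') (hu z hz)
    have hexp : ContMDiffOn (I.prod 𝓘(ℝ, ℝ)) 𝓘(ℝ, ℝ) ∞
        (fun z : M × ℝ ↦ Real.exp (Real.log (u z.2 z.1) * P z.2)) (univ ×ˢ Icc s₂ s₁) :=
      fun z hz ↦ ContDiff.comp_contMDiffWithinAt (g := Real.exp)
        (f := fun z : M × ℝ ↦ Real.log (u z.2 z.1) * P z.2) (x := z) Real.contDiff_exp
        ((hlog.mul hPsm) z hz)
    refine hexp.congr fun z hz ↦ ?_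
    exact Real.rpow_def_of_pos (hupos z.2 hz.2 z.1) _
  -- `Ψ r = ∫ ζ(r) K(·, r) dV_{h(r)} = ∫ u(r)^{P r} dν_r` and its derivative `D r` within `[s₂, s₁]`
  set Ψ : ℝ → ℝ := fun r ↦ ∫ y, ζ r y * K (y, r) ∂(h r).riemVolume with hΨ
  set D : ℝ → ℝ := fun r ↦ ∫ y, (derivWithin (fun r' ↦ ζ r' y) (Icc s₂ s₁) r -
    (h r).laplaceBeltrami (ζ r) y) * K (y, r) ∂(h r).riemVolume with hD
  have hderiv : ∀ r ∈ Icc s₂ s₁, HasDerivWithinAt Ψ (D r) (Icc s₂ s₁) r := fun r hr ↦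
    hflow'.hasDerivWithinAt_integral_mul_conjugateHeat h21 (fun r _ ↦ hR r) hζs hsol hr
  have hΨν : ∀ r ∈ Icc s₂ s₁, Ψ r = ∫ y, u r y ^ P r ∂(heatKernelMeasure hh hR t x r) :=
    fun r hr ↦
    (hflow.integral_heatKernelMeasure_eq_integral_mul_heatKernelFn hh hR ht x (hIt r hr) (ζ r)).symm
  -- `Ψ > 0` and the differential inequality `D ≤ (P'/P) Ψ log Ψ` on `[s₂, s₁]`
  have hkey : ∀ r ∈ Icc s₂ s₁, 0 < Ψ r ∧ D r ≤ P' r / P r * (Ψ r * Real.log (Ψ r)) := by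
    intro r hr
    set ν := heatKernelMeasure hh hR t x r with hν
    have hPr0 := hP0 r hr
    have hur : ContMDiff I 𝓘(ℝ, ℝ) ∞ (u r) := contMDiff_slice_of_contMDiffOn hu hr
    have hur2 : ∀ y, ContMDiffAt I 𝓘(ℝ, ℝ) 2 (u r) y := fun y ↦ (hur.of_le h2le).contMDiffAt
    have hury : ∀ y, u r y ≠ 0 := fun y ↦ (hupos r hr y).ne'
    have hζr : ContMDiff I 𝓘(ℝ, ℝ) ∞ (ζ r) := contMDiff_slice_of_contMDiffOn hζs hr
    have hζpos : ∀ y, 0 < ζ r y := fun y ↦ Real.rpow_pos_of_pos (hupos r hr y) _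
    -- continuity of the slices at time `r`
    have hGc : Continuous fun y ↦ (h r).gradSq (u r) y :=
      (contMDiff_slice_of_contMDiffOn (u := fun r' y ↦ (h r').gradSq (u r') y)
        (hflow'.smooth.contMDiffOn_gradSq hU hu) hr).continuous
    have hrpc : ∀ e : ℝ, Continuous fun y ↦ u r y ^ e := fun e ↦
      hur.continuous.rpow_const fun y ↦ Or.inl (hury y)
    have hAi : Integrable (fun y ↦ u r y ^ P r * Real.log (u r y)) ν :=
      ((hrpc _).mul (hur.continuous.log hury)).integrable_of_hasCompactSupport
        (HasCompactSupport.of_compactSpace _)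
    have hBi : Integrable (fun y ↦ u r y ^ (P r - 2) * (h r).gradSq (u r) y) ν :=
      ((hrpc _).mul hGc).integrable_of_hasCompactSupport (HasCompactSupport.of_compactSpace _)
    set A : ℝ := ∫ y, u r y ^ P r * Real.log (u r y) ∂ν with hA
    set B : ℝ := ∫ y, u r y ^ (P r - 2) * (h r).gradSq (u r) y ∂ν with hB
    -- (i) positivity of `Ψ r = ∫ ζ(r) dν`
    have hΨr : Ψ r = ∫ y, ζ r y ∂ν := hΨν r hr
    have hΨpos : 0 < Ψ r := by
      haveI : Nonempty M := ⟨x⟩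
      obtain ⟨y₀, -, hy₀⟩ :=
        isCompact_univ.exists_isMinOn univ_nonempty hζr.continuous.continuousOn
      have hmin : ∀ y, ζ r y₀ ≤ ζ r y := isMinOn_univ_iff.1 hy₀
      have hζi : Integrable (ζ r) ν :=
        hζr.continuous.integrable_of_hasCompactSupport (HasCompactSupport.of_compactSpace _)
      have h1 : ∫ _y, ζ r y₀ ∂ν ≤ ∫ y, ζ r y ∂ν := integral_mono (integrable_const _) hζi hmin
      rw [integral_const, smul_eq_mul, probReal_univ, one_mul] at h1
      rw [hΨr]
      exact (hζpos y₀).trans_le h1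
    -- (ii) the integrand of `D r`: `∂ᵣζ − Δζ = P' u^P log u − P(P − 1) u^{P−2}|∇u|²`
    have hpt : ∀ y, derivWithin (fun r' ↦ ζ r' y) (Icc s₂ s₁) r - (h r).laplaceBeltrami (ζ r) y =
        P' r * (u r y ^ P r * Real.log (u r y)) -
          P r * (P r - 1) * (u r y ^ (P r - 2) * (h r).gradSq (u r) y) := by
      intro y
      have hd := ((hheat r hr y).rpow (hPd r hr).hasDerivWithinAt (hupos r hr y)).derivWithin
        (hU r hr)
      have hΔ : (h r).laplaceBeltrami (ζ r) y = P r * (P r - 1) * u r y ^ (P r - 2) *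
          (h r).gradSq (u r) y + P r * u r y ^ (P r - 1) * (h r).laplaceBeltrami (u r) y :=
        laplaceBeltrami_fun_rpow (h r) (hur2 y) (hury y) (P r)
      rw [hΔ]
      erw [hd]
      ring
    have hDeq : D r = P' r * A - P r * (P r - 1) * B := by
      have e1 : D r = ∫ y, (P' r * (u r y ^ P r * Real.log (u r y)) -
          P r * (P r - 1) * (u r y ^ (P r - 2) * (h r).gradSq (u r) y)) * K (y, r)
            ∂(h r).riemVolume := by
        simp only [hD]
        exact integral_congr_ae (Eventually.of_forall fun y ↦ by simp only [hpt y])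
      rw [e1, ← hflow.integral_heatKernelMeasure_eq_integral_mul_heatKernelFn hh hR ht x (hIt r hr),
        integral_sub (hAi.const_mul _) (hBi.const_mul _), integral_const_mul, integral_const_mul]
    -- (iii) the log-Sobolev inequality for `φ = ζ(r) = u(r)^{P r}`
    have hLS := heinNaber_logSobolev_heatKernelMeasure hflow hh hR (has₂.trans_le hr.1)
      (hr.2.trans_lt hs₁t) htT x hζr hζpos
    have eA : ∫ y, ζ r y * Real.log (ζ r y) ∂ν = P r * A := by
      rw [hA, ← integral_const_mul]
      refine integral_congr_ae (Eventually.of_forall fun y ↦ ?_)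
      show u r y ^ P r * Real.log (u r y ^ P r) = P r * (u r y ^ P r * Real.log (u r y))
      rw [Real.log_rpow (hupos r hr y)]
      ring
    have eB : ∫ y, (h r).gradSq (ζ r) y / ζ r y ∂ν = P r ^ 2 * B := by
      rw [hB, ← integral_const_mul]
      refine integral_congr_ae (Eventually.of_forall fun y ↦ ?_)
      have hu0 := hupos r hr y
      show (h r).gradSq (fun y ↦ u r y ^ P r) y / u r y ^ P r =
        P r ^ 2 * (u r y ^ (P r - 2) * (h r).gradSq (u r) y)
      rw [gradSq_fun_rpow (h r) ((hur2 y).mdifferentiableAt (by norm_num)) (hury y) (P r), mul_pow,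
        ← Real.rpow_natCast (u r y ^ (P r - 1)) 2, ← Real.rpow_mul hu0.le,
        show (P r - 1) * ((2 : ℕ) : ℝ) = (P r - 2) + P r by push_cast; ring, Real.rpow_add hu0]
      field_simp
    rw [eA, eB, ← hΨr] at hLS
    -- (iv) combine: `D = P'A − P(P−1)B ≤ (P'/P) Ψ log Ψ`
    refine ⟨hΨpos, ?_⟩
    have hcoef : 0 ≤ P' r / P r := (div_pos (hP'0 r hr) hPr0).le
    have h3 := mul_le_mul_of_nonneg_left hLS hcoef
    have e1 : P' r / P r * (P r * A - Ψ r * Real.log (Ψ r)) =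
        P' r * A - P' r / P r * (Ψ r * Real.log (Ψ r)) := by
      field_simp
    have e2 : P' r / P r * ((t - r) * (P r ^ 2 * B)) = P r * (P r - 1) * B := by
      rw [← hPrel r hr]
      field_simp
    rw [e1, e2] at h3
    rw [hDeq]
    linarith
  -- `F r = log Ψ(r) / P(r)` is non-increasing on `[s₂, s₁]`
  set F : ℝ → ℝ := fun r ↦ (P r)⁻¹ * Real.log (Ψ r) with hF
  set F' : ℝ → ℝ := fun r ↦ -P' r / P r ^ 2 * Real.log (Ψ r) + (P r)⁻¹ * (D r / Ψ r) with hF'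
  have hFd : ∀ r ∈ Icc s₂ s₁, HasDerivWithinAt F (F' r) (Icc s₂ s₁) r := by
    intro r hr
    have hΨpos := (hkey r hr).1
    have h1 : HasDerivWithinAt (fun r' ↦ Real.log (Ψ r')) (D r / Ψ r) (Icc s₂ s₁) r :=
      (hderiv r hr).log hΨpos.ne'
    have h2 : HasDerivWithinAt (fun r' ↦ (P r')⁻¹) (-P' r / P r ^ 2) (Icc s₂ s₁) r :=
      ((hPd r hr).hasDerivWithinAt).inv (hP0 r hr).ne'
    exact h2.mul h1
  have hF'le : ∀ r ∈ Icc s₂ s₁, F' r ≤ 0 := by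
    intro r hr
    obtain ⟨hΨpos, hDle⟩ := hkey r hr
    have hPr0 := hP0 r hr
    have h1 : D r / Ψ r ≤ P' r / P r * Real.log (Ψ r) := by
      rw [div_le_iff₀ hΨpos]
      calc D r ≤ P' r / P r * (Ψ r * Real.log (Ψ r)) := hDle
        _ = P' r / P r * Real.log (Ψ r) * Ψ r := by ring
    have h2 : (P r)⁻¹ * (D r / Ψ r) ≤ (P r)⁻¹ * (P' r / P r * Real.log (Ψ r)) :=
      mul_le_mul_of_nonneg_left h1 (inv_nonneg.2 hPr0.le)
    have e : -P' r / P r ^ 2 * Real.log (Ψ r) + (P r)⁻¹ * (P' r / P r * Real.log (Ψ r)) = 0 := by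
      field_simp
      ring
    simp only [hF']
    linarith
  have hFc : ContinuousOn F (Icc s₂ s₁) := fun r hr ↦ (hFd r hr).continuousWithinAt
  have hanti : AntitoneOn F (Icc s₂ s₁) :=
    antitoneOn_of_hasDerivWithinAt_nonpos (convex_Icc s₂ s₁) hFc
      (fun r hr ↦ (hFd r (interior_subset hr)).mono interior_subset)
      fun r hr ↦ hF'le r (interior_subset hr)
  have hF21 : F s₁ ≤ F s₂ := hanti (left_mem_Icc.2 h21.le) (right_mem_Icc.2 h21.le) h21.le
  -- `Ψ(s₁)^{1/P(s₁)} ≤ Ψ(s₂)^{1/q}`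
  have hs₁m : s₁ ∈ Icc s₂ s₁ := right_mem_Icc.2 h21.le
  have hs₂m : s₂ ∈ Icc s₂ s₁ := left_mem_Icc.2 h21.le
  have hΨ1 := (hkey s₁ hs₁m).1
  have hΨ2 := (hkey s₂ hs₂m).1
  have hmid : Ψ s₁ ^ (1 / P s₁) ≤ Ψ s₂ ^ (1 / q) := by
    rw [Real.rpow_def_of_pos hΨ1, Real.rpow_def_of_pos hΨ2, Real.exp_le_exp, ← hPs₂]
    have e1 : Real.log (Ψ s₁) * (1 / P s₁) = F s₁ := by simp only [hF]; ring
    have e2 : Real.log (Ψ s₂) * (1 / P s₂) = F s₂ := by simp only [hF]; ring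
    rw [e1, e2]
    exact hF21
  -- Jensen: `(∫ u(s₁)^p dν_{s₁})^{1/p} ≤ Ψ(s₁)^{1/P(s₁)}`
  set ν₁ := heatKernelMeasure hh hR t x s₁ with hν₁
  have hP10 : 0 < P s₁ := hP0 s₁ hs₁m
  set θ : ℝ := P s₁ / p with hθ
  have hθ1 : 1 ≤ θ := (one_le_div hp0).2 hpP
  have hθ0 : 0 ≤ θ := zero_le_one.trans hθ1
  have hu1 : Continuous (u s₁) := (contMDiff_slice_of_contMDiffOn hu hs₁m).continuous
  have hu1ne : ∀ y, u s₁ y ≠ 0 := fun y ↦ (hupos s₁ hs₁m y).ne'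
  have hfc : Continuous fun y ↦ u s₁ y ^ p := hu1.rpow_const fun y ↦ Or.inl (hu1ne y)
  have hfi : Integrable (fun y ↦ u s₁ y ^ p) ν₁ :=
    hfc.integrable_of_hasCompactSupport (HasCompactSupport.of_compactSpace _)
  have hgc : Continuous fun y ↦ (u s₁ y ^ p) ^ θ := hfc.rpow_const fun _ ↦ Or.inr hθ0
  have hgi : Integrable (fun y ↦ (u s₁ y ^ p) ^ θ) ν₁ :=
    hgc.integrable_of_hasCompactSupport (HasCompactSupport.of_compactSpace _)
  have hJ : (∫ y, u s₁ y ^ p ∂ν₁) ^ θ ≤ ∫ y, (u s₁ y ^ p) ^ θ ∂ν₁ :=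
    (convexOn_rpow hθ1).map_integral_le (Real.continuous_rpow_const hθ0).continuousOn
      isClosed_Ici (Eventually.of_forall fun y ↦ Real.rpow_nonneg (hupos s₁ hs₁m y).le _) hfi hgi
  have hJ' : ∫ y, (u s₁ y ^ p) ^ θ ∂ν₁ = Ψ s₁ := by
    rw [hΨν s₁ hs₁m]
    refine integral_congr_ae (Eventually.of_forall fun y ↦ ?_)
    show (u s₁ y ^ p) ^ θ = u s₁ y ^ P s₁
    rw [← Real.rpow_mul (hupos s₁ hs₁m y).le, hθ, mul_div_cancel₀ _ hp0.ne']
  have hI0 : 0 ≤ ∫ y, u s₁ y ^ p ∂ν₁ :=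
    integral_nonneg fun y ↦ Real.rpow_nonneg (hupos s₁ hs₁m y).le _
  have hleft : (∫ y, u s₁ y ^ p ∂ν₁) ^ (1 / p) ≤ Ψ s₁ ^ (1 / P s₁) := by
    have e : 1 / p = θ * (1 / P s₁) := by
      rw [hθ]
      field_simp
    rw [e, Real.rpow_mul hI0]
    exact Real.rpow_le_rpow (Real.rpow_nonneg hI0 _) (hJ.trans_eq hJ') (by positivity)
  -- conclusion
  have hright : Ψ s₂ = ∫ y, u s₂ y ^ q ∂(heatKernelMeasure hh hR t x s₂) := by
    rw [hΨν s₂ hs₂m, hPs₂]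
  rw [← hright]
  exact hleft.trans hmid

end Hypercontractivity

end Literature.Geometry.Riemannian
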